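import Summits.HodgeConjecture.HodgeConjecture.Theorems.F0P3cStCharTSShellOrbitalGPsi    -- ★ (LH2-p03 g3) D3-ii: `distribHaarChar_congr_of_valued_eq`, `skewModulus_congr_of_valued_eq`, `eventually_valued_torusRatio_sub_one_eq`, `isUnit_of_valued_apply_eq`, `eq_torusEntry_of_glDiagonal_eq`, `eventually_rootDeltaChar_eq`
import Summits.HodgeConjecture.HodgeConjecture.Theorems.F0P3cStCharTSWeylHypWeightId      -- ★ p851690 (LH6-p02 g6) (J7): brings ★ DG-FIELD `DG_coe_torus_eq_vanDijkWeight_re`, ★ VDW-SYMM `vanDijkWeight_eq_of_isUnit`, ★ TorusDefs `vanDijkWeight`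
import Summits.HodgeConjecture.HodgeConjecture.Theorems.F0P3cStCharTSWeylHypMeasure       -- ★ p849733 (LH2-p02 g3) §1: `isRegularElt_glDiagonal_of_isUnit_sub`; brings ★ (A0′) `isUnit_sub_of_isRegularElt_glDiagonal`
import HarnessLib

/-!
# F0 · P3c · line LH6 «StCharTS» — ROAD «JAC-LOC» brick (J6-D) «WEIGHT-LC^CM»: on the split torus of `U(Φ₃)(L⁺_v)` the one-sided twist modules
# `‖a − 1‖·χ⁻(b − 1)`, `‖a_w − 1‖·χ⁻(b_w − 1)`, van Dijk's weight `Δ` and the datum's `D_G` are LOCALLY CONSTANT at a regular element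
# (Harish-Chandra 1970 Lemma 22; van Dijk 1972 §2; Rogawski 1990 §4.9 p. 55, §12.5 p. 182, §12.7 p. 193)
Cell `pub/hodgecm-mathlib`, crux H413 = `stmt-HodgeConjecture-24833` (lane `--supports … --as helper`), route HCCMUnconditional; seat F0P2-p02 (g21), brick
(J6-D) of the road «JAC-LOC» (holder LH6-p03 (g5), board F0∕P3b 2026-09-02T15:28:49Z; consumer (J6) LH6-p04 (g6): the hypothesis `hD`∕«`D ≡ c` on the coset» of
★ p851860 `…TubeCosetIdentity.measure_tube_coset_eq_lintegral`).  CM twin of ★ SHIFT-LC `…RootUnitLocConst` (this seat, p851858), read on the CM carrier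
`R = LocalRing L v = ∏_{w ∣ v} L_w` where a unit's module depends only on its VALUATION VECTOR (★ D3-ii `…ShellOrbitalGPsi` §1–§2, LH2-p03 (g3)).
THEOREMS ONLY, sorry-free, no definition ∕ instance ∕ notation ∕ named fact; ★-only imports.
SETTING.  `L` CM, `v` a finite place of `L⁺` (ANY `v` in §1–§4; NON-SPLIT `hns` only for `D_G` in §5), `σ = conjLocal L c v`, `G = U(Φ₃)(L⁺_v)` on the matrix carrier
`↥(unitaryGroupOfForm σ (cmLocalForm L 3 v))`, `T = (cmBorelTriple L 3 v).M` its diagonal torus with coordinates `eᵢ = torusEntry σ (cmLocalForm L 3 v) i` (canonical writing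
`t = diag(e t)`, ★ `glDiagonal_torusEntry_eq`; every writing `glDiagonal 3 R d = ↑t` has `d = e t`, ★ `eq_torusEntry_of_glDiagonal_eq`).  Root scalars of `t = diag(d)`:
`a = d₀⁻¹d₁`, `b = d₀⁻¹d₂` (★ (J3)), `a_w = d₂⁻¹d₁`, `b_w = d₂⁻¹d₀` (★ (J3⁻)); one-sided twist modules (★ (J7) tokens, `‖·‖ = distribHaarChar R`, `χ⁻ = HeisRing.skewModulus σ`):
`m_N(t) = ‖a − 1‖·χ⁻(b − 1)`, `m_N̄(t) = ‖a_w − 1‖·χ⁻(b_w − 1)`; `Δ = F0P3cStCharTSTorusDefs.vanDijkWeight` (print's `Δ(m)`, p. 193); `D_G = 𝔇.DG` under ★ DG-FIELD's `hDG`.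
* §1 (any commutative ring, any `N`) `coe_inv_mul_sub_one_eq` (`dᵢ⁻¹dⱼ − 1 = dᵢ⁻¹(dⱼ − dᵢ)`), **`isUnit_coe_inv_mul_sub_one_iff`** (`dᵢ⁻¹dⱼ − 1 ∈ Rˣ ↔ dⱼ − dᵢ ∈ Rˣ`),
  **`isUnit_coe_inv_mul_sub_one_of_isRegularElt`** (regular `diag(d)` ⇒ every `dᵢ⁻¹dⱼ − 1`, `i ≠ j`, is a unit; extends ★ TN-CONJ's `isUnit_rootA∕B_sub_one` to all pairs) and
  the `N = 3` converse **`isRegularElt_glDiagonal_of_isUnit_three`** (`a − 1, b − 1, a_w − 1 ∈ Rˣ ⇒ diag(d)` regular, ★ `isRegularElt_glDiagonal_of_isUnit_sub`).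
* §2 (CM torus, any `v`) `eventually_valued_torusEntry_eq` (the valuation vector of `eᵢ t` is locally constant) and **`eventually_isRegularElt_and_valued_rootUnits_eq`**:
  at a REGULAR `t₀` (fixed writing `d₀`), `∀ᶠ t in 𝓝 t₀`, for EVERY writing `d` of `t`: `t` is regular, the four root scalars minus one are UNITS, and their VALUATION VECTORS
  (`w ↦ v_w((dᵢ⁻¹dⱼ − 1)_w)`) equal those at `(t₀, d₀)` — ★ D3-ii `eventually_valued_torusRatio_sub_one_eq` ×4 + §1.
* §3 (any `v`) **`eventually_twist_eq`** ∕ **`eventually_twistRev_eq`** ∕ **`eventually_twist_mul_twistRev_eq`**: `∀ᶠ t in 𝓝 t₀`, for every writing `d` of `t` and ALL unit ∕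
  `σ`-fixedness witnesses `ha hb hσb` (resp. `ha₂ hb₂ hσb₂`): `‖a − 1‖·χ⁻(b − 1)` at `(t, d)` EQUALS the same at `(t₀, d₀)` (resp. the `N̄`-side module, resp. the two-sided product
  `= |det(1 − Ad t)|_{𝔤∕𝔱}|` of ★ (J7)); the witnesses are universally quantified, so ★ (J7)'s ∕ ★ (J4b)'s proof terms (`(isUnit_rootA_sub_one …).unit`,
  `map_unit_torusCentralScalar_sub_one …`) instantiate them verbatim (proof irrelevance).  Open-set form (L3) **`exists_isOpen_twist_eq`**: an OPEN `U ∋ t₀` of `T`,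
  `U ⊆ T^{reg}`, on which all of the above hold — the `U` ∕ «`D ≡ D t₀` on `U`» of ★ p851645 `hJacLoc` and ★ p851860.
* §4 (any `v`) **`eventually_vanDijkWeight_eq`**: `Δ(t) = Δ(t₀)` near a regular `t₀` (★ `vanDijkWeight_eq_of_isUnit` + ★ `eventually_rootDeltaChar_eq` + §3).
* §5 (`v` NON-SPLIT, the (S-𝔇) datum's `D_G` under ★ DG-FIELD's field equation `hDG`) **`eventually_DG_coe_eq`** ∕ **`exists_isOpen_DG_coe_eq`**: `D_G(ι t) = D_G(ι t₀)` near a regular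
  `t₀ ∈ T` (★ `DG_coe_torus_eq_vanDijkWeight_re` + §4) — Harish-Chandra's «`|D(t)|` is locally constant on `T ∩ G^{reg}`» for the split Cartan of `U(Φ₃)(L⁺_v)`.
HONEST LABEL: count-neutral topology∕module bookkeeping for the road «JAC-LOC» (hyperbolic half of the print residue «WIF» of the (S-𝔇) organ `stub_EllipticPackage` of
`Cruxes/H413/Lines/F0_P3c_StCharTSPaydown.lean`); closes no organ.  HC_CM is proved only modulo the 7 printed citations (2 remaining: hLiu418 = `stmt-HodgeConjecture-24832`,
h413 = `stmt-HodgeConjecture-24833`) until rung 0 closes.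
## References
* [HarishChandra1970] Harish-Chandra, *Harmonic analysis on reductive p-adic groups*, LNM 162 (1970), Lemma 22 (Jacobian of conjugation, locally constant on the regular set).
* [vanDijk1972] G. van Dijk, *Computation of certain induced characters of p-adic groups*, Math. Ann. 199 (1972) 229–240, §2.
* [Rogawski1990] J. D. Rogawski, *Automorphic Representations of Unitary Groups in Three Variables*, Ann. of Math. Stud. 123 (1990), §3.1 p. 19, §4.9 pp. 54–56, §12.5 p. 182, §12.7 p. 193.
* [WeilBNT1967] A. Weil, *Basic Number Theory* (1967), Ch. I §2, §4 (the module of an automorphism of a local field depends only on the valuation).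
-/

set_option autoImplicit false
-- the mandated namespace has the single-problem summit's repeated segment (`HodgeConjecture.HodgeConjecture`)
set_option linter.dupNamespace false

noncomputable section

open NumberField IsDedekindDomain MeasureTheory Topology Filter Set
open scoped Matrix MatrixGroups NNReal
open Literature.NumberTheory.Automorphic Literature.NumberTheory.Automorphic.UnitaryGroup Literature.NumberTheory.Rogawski1990
open Summit.HodgeConjecture.HodgeConjecture.Cruxes.H413.F0P3cStCharTSWeylHypFibre (isUnit_sub_of_isRegularElt_glDiagonal)
open Summit.HodgeConjecture.HodgeConjecture.Cruxes.H413.F0P3cStCharTSWeylHypMeasure (isRegularElt_glDiagonal_of_isUnit_sub)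
open Summit.HodgeConjecture.HodgeConjecture.Cruxes.H413.F0P3cStCharTSShellOrbitalG

namespace Summit.HodgeConjecture.HodgeConjecture.Cruxes.H413.F0P3cStCharTSWeightLocConst

/-! ## §1 Root scalars of a diagonal element: units ⇔ regular (any commutative ring) -/

section Ring

variable {R : Type*} [CommRing R] {N : ℕ}

/-- `dᵢ⁻¹dⱼ − 1 = dᵢ⁻¹·(dⱼ − dᵢ)`. [cite: Rogawski1990, §3.1 p. 19] -/
theorem coe_inv_mul_sub_one_eq (d : Fin N → Rˣ) (i j : Fin N) :
    (((d i)⁻¹ * d j : Rˣ) : R) - 1 = (((d i)⁻¹ : Rˣ) : R) * ((d j : R) - d i) := by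
  rw [Units.val_mul, mul_sub, Units.inv_mul]

/-- **`dᵢ⁻¹dⱼ − 1` is a unit iff `dⱼ − dᵢ` is.** [cite: Rogawski1990, §3.1 p. 19] -/
theorem isUnit_coe_inv_mul_sub_one_iff (d : Fin N → Rˣ) (i j : Fin N) :
    IsUnit ((((d i)⁻¹ * d j : Rˣ) : R) - 1) ↔ IsUnit ((d j : R) - d i) := by
  rw [coe_inv_mul_sub_one_eq, Units.isUnit_units_mul]

/-- **Regular `diag(d)` ⇒ every root scalar minus one `dᵢ⁻¹dⱼ − 1` (`i ≠ j`) is a unit** (★ (A0′) `isUnit_sub_of_isRegularElt_glDiagonal`; all pairs, any `N` — ★ TN-CONJ's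
`isUnit_rootA_sub_one`∕`isUnit_rootB_sub_one` are the pairs `(0,1)`, `(0,2)`). [cite: Rogawski1990, §3.1 p. 19; §12.5 p. 182] -/
theorem isUnit_coe_inv_mul_sub_one_of_isRegularElt {d : Fin N → Rˣ} (hreg : IsRegularElt (glDiagonal N R d)) {i j : Fin N} (hij : i ≠ j) :
    IsUnit ((((d i)⁻¹ * d j : Rˣ) : R) - 1) :=
  (isUnit_coe_inv_mul_sub_one_iff d i j).2 (isUnit_sub_of_isRegularElt_glDiagonal hreg hij.symm)

/-- **`N = 3` converse: `a − 1`, `b − 1`, `a_w − 1` units ⇒ `diag(d)` regular** (`a = d₀⁻¹d₁`, `b = d₀⁻¹d₂`, `a_w = d₂⁻¹d₁`; the three pairs give all unit differences,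
★ `isRegularElt_glDiagonal_of_isUnit_sub`). [cite: Rogawski1990, §3.1 p. 19] -/
theorem isRegularElt_glDiagonal_of_isUnit_three {d : Fin 3 → Rˣ}
    (h01 : IsUnit ((((d 0)⁻¹ * d 1 : Rˣ) : R) - 1)) (h02 : IsUnit ((((d 0)⁻¹ * d 2 : Rˣ) : R) - 1))
    (h21 : IsUnit ((((d 2)⁻¹ * d 1 : Rˣ) : R) - 1)) : IsRegularElt (glDiagonal 3 R d) := by
  have h10 : IsUnit ((d 1 : R) - d 0) := (isUnit_coe_inv_mul_sub_one_iff d 0 1).1 h01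
  have h20 : IsUnit ((d 2 : R) - d 0) := (isUnit_coe_inv_mul_sub_one_iff d 0 2).1 h02
  have h12 : IsUnit ((d 1 : R) - d 2) := (isUnit_coe_inv_mul_sub_one_iff d 2 1).1 h21
  have hneg : ∀ x y : R, IsUnit (x - y) → IsUnit (y - x) := fun x y h => by rw [← neg_sub]; exact h.neg
  refine isRegularElt_glDiagonal_of_isUnit_sub fun i j hij => ?_
  fin_cases i <;> fin_cases j
  · exact absurd rfl hij
  · exact hneg _ _ h10
  · exact hneg _ _ h20
  · exact h10
  · exact absurd rfl hij
  · exact h12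
  · exact h20
  · exact hneg _ _ h12
  · exact absurd rfl hij

end Ring

/-! ## §2 The CM torus: regularity and the valuation vectors of the root scalars are locally constant -/

section CM

variable (L : Type) [Field L] [NumberField L] [IsCMField L] (v : HeightOneSpectrum (𝓞 ↥(maximalRealSubfield L)))

/-- **The valuation vector of a coordinate `eᵢ t` is locally constant on `T`** (`eᵢ t` is a unit; continuity ★ `continuous_coe_torusEntry_apply`, Mathlib `Valued.locally_const`
place by place). [cite: WeilBNT1967, Ch. I §2] [cite: Rogawski1990, §1.10 p. 9] -/
theorem eventually_valued_torusEntry_eq (i : Fin 3) (t₀ : ↥(cmBorelTriple L 3 v).M) :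
    ∀ᶠ t : ↥(cmBorelTriple L 3 v).M in 𝓝 t₀, ∀ w' : PlacesOver L v,
      Valued.v (((torusEntry (conjLocal L (IsCMField.complexConj L) v) (cmLocalForm L 3 v) i t : (LocalRing L v)ˣ) : LocalRing L v) w') =
      Valued.v (((torusEntry (conjLocal L (IsCMField.complexConj L) v) (cmLocalForm L 3 v) i t₀ : (LocalRing L v)ˣ) : LocalRing L v) w') := by
  have hc : Continuous fun t : ↥(cmBorelTriple L 3 v).M =>
      ((torusEntry (conjLocal L (IsCMField.complexConj L) v) (cmLocalForm L 3 v) i t : (LocalRing L v)ˣ) : LocalRing L v) :=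
    continuous_coe_torusEntry_apply (conjLocal L (IsCMField.complexConj L) v) (cmLocalForm L 3 v) i
  rw [Filter.eventually_all]
  intro w'
  have hne := valued_apply_ne_zero_of_isUnit L v (torusEntry (conjLocal L (IsCMField.complexConj L) v) (cmLocalForm L 3 v) i t₀).isUnit w'
  have hmem := Valued.locally_const (R := w'.1.adicCompletion L) hne
  exact ((continuous_apply w').comp hc).continuousAt.preimage_mem_nhds hmem

/-- **(J6-D), valuation form — the CM twin of ★ SHIFT-LC `eventually_rootUnitSizes_eq_of_glDiagonal`.**  At a REGULAR `t₀ ∈ T` with a writing `glDiagonal 3 R d₀ = ↑t₀`: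
`∀ᶠ t in 𝓝 t₀`, for EVERY writing `glDiagonal 3 R d = ↑t`: `t` is REGULAR; `a − 1, b − 1, a_w − 1, b_w − 1` at `d` are UNITS; and their valuation vectors equal those at `d₀`
(pairs `(0,1)`, `(0,2)`, `(2,1)`, `(2,0)`). [cite: HarishChandra1970, Lemma 22] [cite: vanDijk1972, §2] [cite: Rogawski1990, §12.5 p. 182] -/
theorem eventually_isRegularElt_and_valued_rootUnits_eq (t₀ : ↥(cmBorelTriple L 3 v).M)
    (hreg : IsRegularElt (((t₀ : ↥(unitaryGroupOfForm (conjLocal L (IsCMField.complexConj L) v) (cmLocalForm L 3 v))) : GL (Fin 3) (LocalRing L v))))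
    {d₀ : Fin 3 → (LocalRing L v)ˣ}
    (hd₀ : glDiagonal 3 (LocalRing L v) d₀ = ((t₀ : ↥(unitaryGroupOfForm (conjLocal L (IsCMField.complexConj L) v) (cmLocalForm L 3 v))) : GL (Fin 3) (LocalRing L v))) :
    ∀ᶠ t : ↥(cmBorelTriple L 3 v).M in 𝓝 t₀, ∀ d : Fin 3 → (LocalRing L v)ˣ,
      glDiagonal 3 (LocalRing L v) d = ((t : ↥(unitaryGroupOfForm (conjLocal L (IsCMField.complexConj L) v) (cmLocalForm L 3 v))) : GL (Fin 3) (LocalRing L v)) →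
      IsRegularElt (((t : ↥(unitaryGroupOfForm (conjLocal L (IsCMField.complexConj L) v) (cmLocalForm L 3 v))) : GL (Fin 3) (LocalRing L v))) ∧
      (IsUnit ((((d 0)⁻¹ * d 1 : (LocalRing L v)ˣ) : LocalRing L v) - 1) ∧ IsUnit ((((d 0)⁻¹ * d 2 : (LocalRing L v)ˣ) : LocalRing L v) - 1) ∧
        IsUnit ((((d 2)⁻¹ * d 1 : (LocalRing L v)ˣ) : LocalRing L v) - 1) ∧ IsUnit ((((d 2)⁻¹ * d 0 : (LocalRing L v)ˣ) : LocalRing L v) - 1)) ∧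
      (∀ w' : PlacesOver L v, Valued.v (((((d 0)⁻¹ * d 1 : (LocalRing L v)ˣ) : LocalRing L v) - 1) w') = Valued.v (((((d₀ 0)⁻¹ * d₀ 1 : (LocalRing L v)ˣ) : LocalRing L v) - 1) w')) ∧
      (∀ w' : PlacesOver L v, Valued.v (((((d 0)⁻¹ * d 2 : (LocalRing L v)ˣ) : LocalRing L v) - 1) w') = Valued.v (((((d₀ 0)⁻¹ * d₀ 2 : (LocalRing L v)ˣ) : LocalRing L v) - 1) w')) ∧
      (∀ w' : PlacesOver L v, Valued.v (((((d 2)⁻¹ * d 1 : (LocalRing L v)ˣ) : LocalRing L v) - 1) w') = Valued.v (((((d₀ 2)⁻¹ * d₀ 1 : (LocalRing L v)ˣ) : LocalRing L v) - 1) w')) ∧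
      (∀ w' : PlacesOver L v, Valued.v (((((d 2)⁻¹ * d 0 : (LocalRing L v)ˣ) : LocalRing L v) - 1) w') = Valued.v (((((d₀ 2)⁻¹ * d₀ 0 : (LocalRing L v)ˣ) : LocalRing L v) - 1) w')) := by
  obtain rfl := eq_torusEntry_of_glDiagonal_eq L v t₀ d₀ hd₀
  have hreg₀ : IsRegularElt (glDiagonal 3 (LocalRing L v)
      (fun i : Fin 3 => torusEntry (conjLocal L (IsCMField.complexConj L) v) (cmLocalForm L 3 v) i t₀)) := by
    rw [glDiagonal_torusEntry_eq L v t₀]; exact hreg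
  have u01 := isUnit_coe_inv_mul_sub_one_of_isRegularElt hreg₀ (i := 0) (j := 1) (by decide)
  have u02 := isUnit_coe_inv_mul_sub_one_of_isRegularElt hreg₀ (i := 0) (j := 2) (by decide)
  have u21 := isUnit_coe_inv_mul_sub_one_of_isRegularElt hreg₀ (i := 2) (j := 1) (by decide)
  have u20 := isUnit_coe_inv_mul_sub_one_of_isRegularElt hreg₀ (i := 2) (j := 0) (by decide)
  have h01 := eventually_valued_torusRatio_sub_one_eq L v 0 1 t₀ u01
  have h02 := eventually_valued_torusRatio_sub_one_eq L v 0 2 t₀ u02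
  have h21 := eventually_valued_torusRatio_sub_one_eq L v 2 1 t₀ u21
  have h20 := eventually_valued_torusRatio_sub_one_eq L v 2 0 t₀ u20
  filter_upwards [h01, h02, h21, h20] with t ht01 ht02 ht21 ht20 d hd
  obtain rfl := eq_torusEntry_of_glDiagonal_eq L v t d hd
  have v01 := isUnit_of_valued_apply_eq L v u01 ht01
  have v02 := isUnit_of_valued_apply_eq L v u02 ht02
  have v21 := isUnit_of_valued_apply_eq L v u21 ht21
  have v20 := isUnit_of_valued_apply_eq L v u20 ht20
  refine ⟨?_, ⟨v01, v02, v21, v20⟩, ht01, ht02, ht21, ht20⟩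
  rw [← glDiagonal_torusEntry_eq L v t]
  exact isRegularElt_glDiagonal_of_isUnit_three v01 v02 v21

/-! ## §3 The one-sided twist modules `‖a − 1‖·χ⁻(b − 1)`, `‖a_w − 1‖·χ⁻(b_w − 1)` are locally constant at a regular `t₀` -/

set_option maxHeartbeats 1600000 in
set_option synthInstance.maxHeartbeats 400000 in
/-- **(J6-D) «WEIGHT-LC^CM», the `N`-side module**: at `t₀ ∈ T` with a writing `d₀` whose `a − 1`, `b − 1` are units (`σ`-fixedness witness `hσb₀`): `∀ᶠ t in 𝓝 t₀`, for EVERY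
writing `d` of `t` and ALL witnesses `ha hb hσb`, `‖a − 1‖·χ⁻(b − 1)` at `(t, d)` equals the same at `(t₀, d₀)` (★ `distribHaarChar_congr_of_valued_eq`, ★ `skewModulus_congr_of_valued_eq`
over §2's valuation vectors).  The ★ (J7)∕(J4b) tokens `(isUnit_rootA_sub_one …).unit`, `map_unit_torusCentralScalar_sub_one …` instantiate the witnesses.
[cite: HarishChandra1970, Lemma 22] [cite: Rogawski1990, §4.9 p. 55; §12.5 p. 182] [cite: WeilBNT1967, Ch. I §4 Th. 6] -/
theorem eventually_twist_eq (t₀ : ↥(cmBorelTriple L 3 v).M) {d₀ : Fin 3 → (LocalRing L v)ˣ}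
    (hd₀ : glDiagonal 3 (LocalRing L v) d₀ = ((t₀ : ↥(unitaryGroupOfForm (conjLocal L (IsCMField.complexConj L) v) (cmLocalForm L 3 v))) : GL (Fin 3) (LocalRing L v)))
    (ha₀ : IsUnit ((((d₀ 0)⁻¹ * d₀ 1 : (LocalRing L v)ˣ) : LocalRing L v) - 1))
    (hb₀ : IsUnit ((((d₀ 0)⁻¹ * d₀ 2 : (LocalRing L v)ˣ) : LocalRing L v) - 1))
    (hσb₀ : (conjLocal L (IsCMField.complexConj L) v) ((hb₀.unit : (LocalRing L v)ˣ) : LocalRing L v) = hb₀.unit) :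
    ∀ᶠ t : ↥(cmBorelTriple L 3 v).M in 𝓝 t₀, ∀ d : Fin 3 → (LocalRing L v)ˣ,
      glDiagonal 3 (LocalRing L v) d = ((t : ↥(unitaryGroupOfForm (conjLocal L (IsCMField.complexConj L) v) (cmLocalForm L 3 v))) : GL (Fin 3) (LocalRing L v)) →
      ∀ (ha : IsUnit ((((d 0)⁻¹ * d 1 : (LocalRing L v)ˣ) : LocalRing L v) - 1)) (hb : IsUnit ((((d 0)⁻¹ * d 2 : (LocalRing L v)ˣ) : LocalRing L v) - 1))
        (hσb : (conjLocal L (IsCMField.complexConj L) v) ((hb.unit : (LocalRing L v)ˣ) : LocalRing L v) = hb.unit),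
      (letI : MeasurableSpace (LocalRing L v) := borel _; haveI : BorelSpace (LocalRing L v) := ⟨rfl⟩
        haveI : SecondCountableTopology (LocalRing L v) := secondCountableTopology_localRing (E := L) v
        (distribHaarChar (LocalRing L v) ha.unit *
          HeisRing.skewModulus (conjLocal L (IsCMField.complexConj L) v) (continuous_conjLocal L (IsCMField.complexConj L) v) hb.unit hσb : ℝ≥0)) =
      (letI : MeasurableSpace (LocalRing L v) := borel _; haveI : BorelSpace (LocalRing L v) := ⟨rfl⟩
        haveI : SecondCountableTopology (LocalRing L v) := secondCountableTopology_localRing (E := L) v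
        (distribHaarChar (LocalRing L v) ha₀.unit *
          HeisRing.skewModulus (conjLocal L (IsCMField.complexConj L) v) (continuous_conjLocal L (IsCMField.complexConj L) v) hb₀.unit hσb₀ : ℝ≥0)) := by
  have hd₀' := hd₀
  obtain rfl := eq_torusEntry_of_glDiagonal_eq L v t₀ d₀ hd₀
  have h01 := eventually_valued_torusRatio_sub_one_eq L v 0 1 t₀ ha₀
  have h02 := eventually_valued_torusRatio_sub_one_eq L v 0 2 t₀ hb₀
  filter_upwards [h01, h02] with t ht01 ht02 d hd ha hb hσb
  obtain rfl := eq_torusEntry_of_glDiagonal_eq L v t d hd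
  have h1 := distribHaarChar_congr_of_valued_eq L v ha.unit ha₀.unit
    (fun w' => by rw [IsUnit.unit_spec, IsUnit.unit_spec]; exact ht01 w')
  have h2 := skewModulus_congr_of_valued_eq L v hσb hσb₀ (fun w' => by rw [IsUnit.unit_spec, IsUnit.unit_spec]; exact ht02 w')
  rw [h1, h2]

set_option maxHeartbeats 1600000 in
set_option synthInstance.maxHeartbeats 400000 in
/-- **(J6-D), the `N̄`-side module**: the same for `‖a_w − 1‖·χ⁻(b_w − 1)` (`a_w = d₂⁻¹d₁`, `b_w = d₂⁻¹d₀`, the tokens of ★ (J3⁻) ∕ ★ (J7) `twist_mul_twist_rev_eq_vanDijkWeight_re_sq`).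
[cite: HarishChandra1970, Lemma 22] [cite: Rogawski1990, §4.9 p. 55; §12.5 p. 182] -/
theorem eventually_twistRev_eq (t₀ : ↥(cmBorelTriple L 3 v).M) {d₀ : Fin 3 → (LocalRing L v)ˣ}
    (hd₀ : glDiagonal 3 (LocalRing L v) d₀ = ((t₀ : ↥(unitaryGroupOfForm (conjLocal L (IsCMField.complexConj L) v) (cmLocalForm L 3 v))) : GL (Fin 3) (LocalRing L v)))
    (ha₀ : IsUnit ((((d₀ 2)⁻¹ * d₀ 1 : (LocalRing L v)ˣ) : LocalRing L v) - 1))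
    (hb₀ : IsUnit ((((d₀ 2)⁻¹ * d₀ 0 : (LocalRing L v)ˣ) : LocalRing L v) - 1))
    (hσb₀ : (conjLocal L (IsCMField.complexConj L) v) ((hb₀.unit : (LocalRing L v)ˣ) : LocalRing L v) = hb₀.unit) :
    ∀ᶠ t : ↥(cmBorelTriple L 3 v).M in 𝓝 t₀, ∀ d : Fin 3 → (LocalRing L v)ˣ,
      glDiagonal 3 (LocalRing L v) d = ((t : ↥(unitaryGroupOfForm (conjLocal L (IsCMField.complexConj L) v) (cmLocalForm L 3 v))) : GL (Fin 3) (LocalRing L v)) →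
      ∀ (ha : IsUnit ((((d 2)⁻¹ * d 1 : (LocalRing L v)ˣ) : LocalRing L v) - 1)) (hb : IsUnit ((((d 2)⁻¹ * d 0 : (LocalRing L v)ˣ) : LocalRing L v) - 1))
        (hσb : (conjLocal L (IsCMField.complexConj L) v) ((hb.unit : (LocalRing L v)ˣ) : LocalRing L v) = hb.unit),
      (letI : MeasurableSpace (LocalRing L v) := borel _; haveI : BorelSpace (LocalRing L v) := ⟨rfl⟩
        haveI : SecondCountableTopology (LocalRing L v) := secondCountableTopology_localRing (E := L) v
        (distribHaarChar (LocalRing L v) ha.unit *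
          HeisRing.skewModulus (conjLocal L (IsCMField.complexConj L) v) (continuous_conjLocal L (IsCMField.complexConj L) v) hb.unit hσb : ℝ≥0)) =
      (letI : MeasurableSpace (LocalRing L v) := borel _; haveI : BorelSpace (LocalRing L v) := ⟨rfl⟩
        haveI : SecondCountableTopology (LocalRing L v) := secondCountableTopology_localRing (E := L) v
        (distribHaarChar (LocalRing L v) ha₀.unit *
          HeisRing.skewModulus (conjLocal L (IsCMField.complexConj L) v) (continuous_conjLocal L (IsCMField.complexConj L) v) hb₀.unit hσb₀ : ℝ≥0)) := by
  obtain rfl := eq_torusEntry_of_glDiagonal_eq L v t₀ d₀ hd₀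
  have h21 := eventually_valued_torusRatio_sub_one_eq L v 2 1 t₀ ha₀
  have h20 := eventually_valued_torusRatio_sub_one_eq L v 2 0 t₀ hb₀
  filter_upwards [h21, h20] with t ht21 ht20 d hd ha hb hσb
  obtain rfl := eq_torusEntry_of_glDiagonal_eq L v t d hd
  have h1 := distribHaarChar_congr_of_valued_eq L v ha.unit ha₀.unit
    (fun w' => by rw [IsUnit.unit_spec, IsUnit.unit_spec]; exact ht21 w')
  have h2 := skewModulus_congr_of_valued_eq L v hσb hσb₀ (fun w' => by rw [IsUnit.unit_spec, IsUnit.unit_spec]; exact ht20 w')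
  rw [h1, h2]

/-- **(J6-D), the two-sided module** `m_N(t)·m_N̄(t) = |det(1 − Ad t)|_{𝔤∕𝔱}|` (the left side of ★ (J7) `twist_mul_twist_rev_eq_vanDijkWeight_re_sq`, as a real number) is locally
constant at `t₀`: for every writing `d` of `t` near `t₀` and all witnesses, the product at `(t, d)` equals the product at `(t₀, d₀)`.
[cite: HarishChandra1970, Lemma 22] [cite: Rogawski1990, §12.5 p. 182; §12.7 L. 12.7.2 (proof) p. 193] -/
theorem eventually_twist_mul_twistRev_eq (t₀ : ↥(cmBorelTriple L 3 v).M) {d₀ : Fin 3 → (LocalRing L v)ˣ}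
    (hd₀ : glDiagonal 3 (LocalRing L v) d₀ = ((t₀ : ↥(unitaryGroupOfForm (conjLocal L (IsCMField.complexConj L) v) (cmLocalForm L 3 v))) : GL (Fin 3) (LocalRing L v)))
    (ha₀ : IsUnit ((((d₀ 0)⁻¹ * d₀ 1 : (LocalRing L v)ˣ) : LocalRing L v) - 1))
    (hb₀ : IsUnit ((((d₀ 0)⁻¹ * d₀ 2 : (LocalRing L v)ˣ) : LocalRing L v) - 1))
    (hσb₀ : (conjLocal L (IsCMField.complexConj L) v) ((hb₀.unit : (LocalRing L v)ˣ) : LocalRing L v) = hb₀.unit)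
    (ha₂₀ : IsUnit ((((d₀ 2)⁻¹ * d₀ 1 : (LocalRing L v)ˣ) : LocalRing L v) - 1))
    (hb₂₀ : IsUnit ((((d₀ 2)⁻¹ * d₀ 0 : (LocalRing L v)ˣ) : LocalRing L v) - 1))
    (hσb₂₀ : (conjLocal L (IsCMField.complexConj L) v) ((hb₂₀.unit : (LocalRing L v)ˣ) : LocalRing L v) = hb₂₀.unit) :
    ∀ᶠ t : ↥(cmBorelTriple L 3 v).M in 𝓝 t₀, ∀ d : Fin 3 → (LocalRing L v)ˣ,
      glDiagonal 3 (LocalRing L v) d = ((t : ↥(unitaryGroupOfForm (conjLocal L (IsCMField.complexConj L) v) (cmLocalForm L 3 v))) : GL (Fin 3) (LocalRing L v)) →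
      ∀ (ha : IsUnit ((((d 0)⁻¹ * d 1 : (LocalRing L v)ˣ) : LocalRing L v) - 1)) (hb : IsUnit ((((d 0)⁻¹ * d 2 : (LocalRing L v)ˣ) : LocalRing L v) - 1))
        (hσb : (conjLocal L (IsCMField.complexConj L) v) ((hb.unit : (LocalRing L v)ˣ) : LocalRing L v) = hb.unit)
        (ha₂ : IsUnit ((((d 2)⁻¹ * d 1 : (LocalRing L v)ˣ) : LocalRing L v) - 1)) (hb₂ : IsUnit ((((d 2)⁻¹ * d 0 : (LocalRing L v)ˣ) : LocalRing L v) - 1))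
        (hσb₂ : (conjLocal L (IsCMField.complexConj L) v) ((hb₂.unit : (LocalRing L v)ˣ) : LocalRing L v) = hb₂.unit),
      ((letI : MeasurableSpace (LocalRing L v) := borel _; haveI : BorelSpace (LocalRing L v) := ⟨rfl⟩
        haveI : SecondCountableTopology (LocalRing L v) := secondCountableTopology_localRing (E := L) v
        ((distribHaarChar (LocalRing L v) ha.unit *
            HeisRing.skewModulus (conjLocal L (IsCMField.complexConj L) v) (continuous_conjLocal L (IsCMField.complexConj L) v) hb.unit hσb) *
          (distribHaarChar (LocalRing L v) ha₂.unit *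
            HeisRing.skewModulus (conjLocal L (IsCMField.complexConj L) v) (continuous_conjLocal L (IsCMField.complexConj L) v) hb₂.unit hσb₂) : ℝ≥0)) : ℝ) =
      ((letI : MeasurableSpace (LocalRing L v) := borel _; haveI : BorelSpace (LocalRing L v) := ⟨rfl⟩
        haveI : SecondCountableTopology (LocalRing L v) := secondCountableTopology_localRing (E := L) v
        ((distribHaarChar (LocalRing L v) ha₀.unit *
            HeisRing.skewModulus (conjLocal L (IsCMField.complexConj L) v) (continuous_conjLocal L (IsCMField.complexConj L) v) hb₀.unit hσb₀) *
          (distribHaarChar (LocalRing L v) ha₂₀.unit *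
            HeisRing.skewModulus (conjLocal L (IsCMField.complexConj L) v) (continuous_conjLocal L (IsCMField.complexConj L) v) hb₂₀.unit hσb₂₀) : ℝ≥0)) : ℝ) := by
  filter_upwards [eventually_twist_eq L v t₀ hd₀ ha₀ hb₀ hσb₀, eventually_twistRev_eq L v t₀ hd₀ ha₂₀ hb₂₀ hσb₂₀] with t ht ht' d hd ha hb hσb ha₂ hb₂ hσb₂
  rw [ht d hd ha hb hσb, ht' d hd ha₂ hb₂ hσb₂]

/-- **(L3) «WEIGHT-LC^CM», open-set form** (the `U` of ★ p851645's `hJacLoc`, the «`D ≡ D s` on the coset» of ★ p851860): around a REGULAR `t₀ ∈ T` (writing `d₀`, witnesses at `t₀`)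
there is an OPEN `U ∋ t₀` of `T` such that every `t ∈ U` is REGULAR and, for every writing `d` of `t`: the four root scalars minus one are units, and for all witnesses the
`N`-side module, the `N̄`-side module (and hence their product) at `(t, d)` equal those at `(t₀, d₀)`. [cite: HarishChandra1970, Lemma 22] [cite: Rogawski1990, §12.5 p. 182] -/
theorem exists_isOpen_twist_eq (t₀ : ↥(cmBorelTriple L 3 v).M)
    (hreg : IsRegularElt (((t₀ : ↥(unitaryGroupOfForm (conjLocal L (IsCMField.complexConj L) v) (cmLocalForm L 3 v))) : GL (Fin 3) (LocalRing L v))))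
    {d₀ : Fin 3 → (LocalRing L v)ˣ}
    (hd₀ : glDiagonal 3 (LocalRing L v) d₀ = ((t₀ : ↥(unitaryGroupOfForm (conjLocal L (IsCMField.complexConj L) v) (cmLocalForm L 3 v))) : GL (Fin 3) (LocalRing L v)))
    (ha₀ : IsUnit ((((d₀ 0)⁻¹ * d₀ 1 : (LocalRing L v)ˣ) : LocalRing L v) - 1))
    (hb₀ : IsUnit ((((d₀ 0)⁻¹ * d₀ 2 : (LocalRing L v)ˣ) : LocalRing L v) - 1))
    (hσb₀ : (conjLocal L (IsCMField.complexConj L) v) ((hb₀.unit : (LocalRing L v)ˣ) : LocalRing L v) = hb₀.unit)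
    (ha₂₀ : IsUnit ((((d₀ 2)⁻¹ * d₀ 1 : (LocalRing L v)ˣ) : LocalRing L v) - 1))
    (hb₂₀ : IsUnit ((((d₀ 2)⁻¹ * d₀ 0 : (LocalRing L v)ˣ) : LocalRing L v) - 1))
    (hσb₂₀ : (conjLocal L (IsCMField.complexConj L) v) ((hb₂₀.unit : (LocalRing L v)ˣ) : LocalRing L v) = hb₂₀.unit) :
    ∃ U : Set ↥(cmBorelTriple L 3 v).M, IsOpen U ∧ t₀ ∈ U ∧ ∀ t : ↥(cmBorelTriple L 3 v).M, t ∈ U →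
      IsRegularElt (((t : ↥(unitaryGroupOfForm (conjLocal L (IsCMField.complexConj L) v) (cmLocalForm L 3 v))) : GL (Fin 3) (LocalRing L v))) ∧
      ∀ d : Fin 3 → (LocalRing L v)ˣ,
        glDiagonal 3 (LocalRing L v) d = ((t : ↥(unitaryGroupOfForm (conjLocal L (IsCMField.complexConj L) v) (cmLocalForm L 3 v))) : GL (Fin 3) (LocalRing L v)) →
        (IsUnit ((((d 0)⁻¹ * d 1 : (LocalRing L v)ˣ) : LocalRing L v) - 1) ∧ IsUnit ((((d 0)⁻¹ * d 2 : (LocalRing L v)ˣ) : LocalRing L v) - 1) ∧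
          IsUnit ((((d 2)⁻¹ * d 1 : (LocalRing L v)ˣ) : LocalRing L v) - 1) ∧ IsUnit ((((d 2)⁻¹ * d 0 : (LocalRing L v)ˣ) : LocalRing L v) - 1)) ∧
        (∀ (ha : IsUnit ((((d 0)⁻¹ * d 1 : (LocalRing L v)ˣ) : LocalRing L v) - 1)) (hb : IsUnit ((((d 0)⁻¹ * d 2 : (LocalRing L v)ˣ) : LocalRing L v) - 1))
          (hσb : (conjLocal L (IsCMField.complexConj L) v) ((hb.unit : (LocalRing L v)ˣ) : LocalRing L v) = hb.unit),
          (letI : MeasurableSpace (LocalRing L v) := borel _; haveI : BorelSpace (LocalRing L v) := ⟨rfl⟩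
            haveI : SecondCountableTopology (LocalRing L v) := secondCountableTopology_localRing (E := L) v
            (distribHaarChar (LocalRing L v) ha.unit *
              HeisRing.skewModulus (conjLocal L (IsCMField.complexConj L) v) (continuous_conjLocal L (IsCMField.complexConj L) v) hb.unit hσb : ℝ≥0)) =
          (letI : MeasurableSpace (LocalRing L v) := borel _; haveI : BorelSpace (LocalRing L v) := ⟨rfl⟩
            haveI : SecondCountableTopology (LocalRing L v) := secondCountableTopology_localRing (E := L) v
            (distribHaarChar (LocalRing L v) ha₀.unit *
              HeisRing.skewModulus (conjLocal L (IsCMField.complexConj L) v) (continuous_conjLocal L (IsCMField.complexConj L) v) hb₀.unit hσb₀ : ℝ≥0))) ∧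
        (∀ (ha₂ : IsUnit ((((d 2)⁻¹ * d 1 : (LocalRing L v)ˣ) : LocalRing L v) - 1)) (hb₂ : IsUnit ((((d 2)⁻¹ * d 0 : (LocalRing L v)ˣ) : LocalRing L v) - 1))
          (hσb₂ : (conjLocal L (IsCMField.complexConj L) v) ((hb₂.unit : (LocalRing L v)ˣ) : LocalRing L v) = hb₂.unit),
          (letI : MeasurableSpace (LocalRing L v) := borel _; haveI : BorelSpace (LocalRing L v) := ⟨rfl⟩
            haveI : SecondCountableTopology (LocalRing L v) := secondCountableTopology_localRing (E := L) v
            (distribHaarChar (LocalRing L v) ha₂.unit *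
              HeisRing.skewModulus (conjLocal L (IsCMField.complexConj L) v) (continuous_conjLocal L (IsCMField.complexConj L) v) hb₂.unit hσb₂ : ℝ≥0)) =
          (letI : MeasurableSpace (LocalRing L v) := borel _; haveI : BorelSpace (LocalRing L v) := ⟨rfl⟩
            haveI : SecondCountableTopology (LocalRing L v) := secondCountableTopology_localRing (E := L) v
            (distribHaarChar (LocalRing L v) ha₂₀.unit *
              HeisRing.skewModulus (conjLocal L (IsCMField.complexConj L) v) (continuous_conjLocal L (IsCMField.complexConj L) v) hb₂₀.unit hσb₂₀ : ℝ≥0))) := by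
  obtain ⟨U, hU, hUo, ht₀⟩ := mem_nhds_iff.1 ((eventually_isRegularElt_and_valued_rootUnits_eq L v t₀ hreg hd₀).and
    ((eventually_twist_eq L v t₀ hd₀ ha₀ hb₀ hσb₀).and (eventually_twistRev_eq L v t₀ hd₀ ha₂₀ hb₂₀ hσb₂₀)))
  refine ⟨U, hUo, ht₀, fun t ht => ⟨((hU ht).1 _ (glDiagonal_torusEntry_eq L v t)).1, fun d hd => ⟨((hU ht).1 d hd).2.1, ?_, ?_⟩⟩⟩
  · exact fun ha hb hσb => (hU ht).2.1 d hd ha hb hσb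
  · exact fun ha₂ hb₂ hσb₂ => (hU ht).2.2 d hd ha₂ hb₂ hσb₂

/-! ## §4 Van Dijk's weight `Δ` is locally constant at a regular element -/

set_option maxHeartbeats 1600000 in
set_option synthInstance.maxHeartbeats 400000 in
/-- **`Δ(t) = Δ(t₀)` near a regular `t₀`** (`Δ = F0P3cStCharTSTorusDefs.vanDijkWeight = δ_B^{1∕2} · (‖a − 1‖⁻¹·χ⁻(b − 1)⁻¹)⁻¹` on the regular locus, ★ `vanDijkWeight_eq_of_isUnit`;
`δ_B^{1∕2}` is locally constant ★ `eventually_rootDeltaChar_eq`, the modules by §3; regularity = units of `a − 1`, `b − 1` of the canonical writing propagates by §2).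
[cite: Rogawski1990, §12.7 L. 12.7.2 (proof) p. 193; §4.9 (4.9.4) p. 56] [cite: HarishChandra1970, Lemma 22] -/
theorem eventually_vanDijkWeight_eq (t₀ : ↥(cmBorelTriple L 3 v).M)
    (ha₀ : IsUnit ((((torusEntry (conjLocal L (IsCMField.complexConj L) v) (cmLocalForm L 3 v) 0 t₀)⁻¹ *
        torusEntry (conjLocal L (IsCMField.complexConj L) v) (cmLocalForm L 3 v) 1 t₀ : (LocalRing L v)ˣ) : LocalRing L v) - 1))
    (hb₀ : IsUnit ((((torusEntry (conjLocal L (IsCMField.complexConj L) v) (cmLocalForm L 3 v) 0 t₀)⁻¹ *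
        torusEntry (conjLocal L (IsCMField.complexConj L) v) (cmLocalForm L 3 v) 2 t₀ : (LocalRing L v)ˣ) : LocalRing L v) - 1)) :
    ∀ᶠ t : ↥(cmBorelTriple L 3 v).M in 𝓝 t₀, F0P3cStCharTSTorusDefs.vanDijkWeight L v t = F0P3cStCharTSTorusDefs.vanDijkWeight L v t₀ := by
  have h01 := eventually_valued_torusRatio_sub_one_eq L v 0 1 t₀ ha₀
  have h02 := eventually_valued_torusRatio_sub_one_eq L v 0 2 t₀ hb₀
  have hδ := eventually_rootDeltaChar_eq L v t₀
  filter_upwards [h01, h02, hδ] with t ht01 ht02 htδ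
  have ha : IsUnit ((((torusEntry (conjLocal L (IsCMField.complexConj L) v) (cmLocalForm L 3 v) 0 t)⁻¹ *
      torusEntry (conjLocal L (IsCMField.complexConj L) v) (cmLocalForm L 3 v) 1 t : (LocalRing L v)ˣ) : LocalRing L v) - 1) := isUnit_of_valued_apply_eq L v ha₀ ht01
  have hb : IsUnit ((((torusEntry (conjLocal L (IsCMField.complexConj L) v) (cmLocalForm L 3 v) 0 t)⁻¹ *
      torusEntry (conjLocal L (IsCMField.complexConj L) v) (cmLocalForm L 3 v) 2 t : (LocalRing L v)ˣ) : LocalRing L v) - 1) := isUnit_of_valued_apply_eq L v hb₀ ht02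
  have h1 := distribHaarChar_congr_of_valued_eq L v ha.unit ha₀.unit
    (fun w' => by rw [IsUnit.unit_spec, IsUnit.unit_spec]; exact ht01 w')
  have h2 := skewModulus_congr_of_valued_eq L v
    (HeisRing.map_unit_torusCentralScalar_sub_one (conjLocal L (IsCMField.complexConj L) v) (cmLocalForm_eq_over L 3 v) t
      (F0P3cStCharTSTorusDefs.glDiagonal_torusEntry L v t) hb)
    (HeisRing.map_unit_torusCentralScalar_sub_one (conjLocal L (IsCMField.complexConj L) v) (cmLocalForm_eq_over L 3 v) t₀
      (F0P3cStCharTSTorusDefs.glDiagonal_torusEntry L v t₀) hb₀)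
    (fun w' => by rw [IsUnit.unit_spec, IsUnit.unit_spec]; exact ht02 w')
  rw [F0P3cStCharTSVanDijkWeylSymm.vanDijkWeight_eq_of_isUnit L v t ha hb, F0P3cStCharTSVanDijkWeylSymm.vanDijkWeight_eq_of_isUnit L v t₀ ha₀ hb₀, htδ, h1, h2]

/-- **`Δ(t) = Δ(t₀)` near a REGULAR `t₀`** (regularity in the `IsRegularElt` sense ⇒ the units of §4 via §1 on the canonical writing). [cite: Rogawski1990, §12.7 L. 12.7.2 (proof) p. 193] -/
theorem eventually_vanDijkWeight_eq_of_isRegularElt (t₀ : ↥(cmBorelTriple L 3 v).M)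
    (hreg : IsRegularElt (((t₀ : ↥(unitaryGroupOfForm (conjLocal L (IsCMField.complexConj L) v) (cmLocalForm L 3 v))) : GL (Fin 3) (LocalRing L v)))) :
    ∀ᶠ t : ↥(cmBorelTriple L 3 v).M in 𝓝 t₀, F0P3cStCharTSTorusDefs.vanDijkWeight L v t = F0P3cStCharTSTorusDefs.vanDijkWeight L v t₀ := by
  have hreg₀ : IsRegularElt (glDiagonal 3 (LocalRing L v)
      (fun i : Fin 3 => torusEntry (conjLocal L (IsCMField.complexConj L) v) (cmLocalForm L 3 v) i t₀)) := by
    rw [glDiagonal_torusEntry_eq L v t₀]; exact hreg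
  exact eventually_vanDijkWeight_eq L v t₀ (isUnit_coe_inv_mul_sub_one_of_isRegularElt hreg₀ (i := 0) (j := 1) (by decide))
    (isUnit_coe_inv_mul_sub_one_of_isRegularElt hreg₀ (i := 0) (j := 2) (by decide))

/-! ## §5 The datum's `D_G` is locally constant on the regular part of the split torus (`v` non-split) -/

variable {H : Type} [Group H] [TopologicalSpace H] [IsTopologicalGroup H] [MeasurableSpace H]

/-- **(J6-D) for the organ's `D_G`: `D_G(ι t) = D_G(ι t₀)` near a REGULAR `t₀` of the split torus** (`v` NON-SPLIT; `D_G` the (S-𝔇) datum's closed Weyl discriminant under ★ DG-FIELD's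
field equation `hDG`): ★ `DG_coe_torus_eq_vanDijkWeight_re` (`D_G ∘ ι = Re Δ` on `T`) and §4.  This is Harish-Chandra's «`|D(t)|` is locally constant on `T ∩ G^{reg}`» for the split
Cartan subgroup of `U(Φ₃)(L⁺_v)` — the `hD` of ★ p851860 ∕ the weight clause of ★ p851645's `hJacLoc`. [cite: HarishChandra1970, Lemma 22] [cite: Rogawski1990, §4.9 p. 54; §12.5 p. 182] -/
theorem eventually_DG_coe_eq (hns : ∀ w : PlacesOver L v, IsCMField.complexConj L • w.1 = w.1)
    [MeasurableSpace (Gqs L v)]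
    [∀ γ : Gqs L v, MeasurableSpace (Gqs L v ⧸ Subgroup.centralizer ({γ} : Set (Gqs L v)))] [MeasurableSpace (Gqs L v ⧸ Subgroup.center (Gqs L v))]
    (𝔇 : Ch12Sec5.EllipticData (Gqs L v) H)
    (hDG : ∀ g : Gqs L v, 𝔇.DG g =
      ((NNReal.sqrt (NNReal.sqrt
        ((∏ w : PlacesOver L v, Literature.NumberTheory.GaloisRepresentations.IsNonarchimedeanLocalField.normAbs (w.1.adicCompletion L)
            (((g.val : GL (Fin 3) (UnitaryGroup.LocalRing L v)).val.charpoly.discr) w)) *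
          ((∏ w : PlacesOver L v, Literature.NumberTheory.GaloisRepresentations.IsNonarchimedeanLocalField.normAbs (w.1.adicCompletion L)
            (((g.val : GL (Fin 3) (UnitaryGroup.LocalRing L v)).val.det) w)) ^ 2)⁻¹)) : ℝ≥0) : ℝ))
    (t₀ : ↥(cmBorelTriple L 3 v).M)
    (hreg : IsRegularElt (((t₀ : ↥(unitaryGroupOfForm (conjLocal L (IsCMField.complexConj L) v) (cmLocalForm L 3 v))) : GL (Fin 3) (LocalRing L v)))) :
    ∀ᶠ t : ↥(cmBorelTriple L 3 v).M in 𝓝 t₀,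
      𝔇.DG ((t : ↥(unitaryGroupOfForm (conjLocal L (IsCMField.complexConj L) v) (cmLocalForm L 3 v))) : Gqs L v) =
      𝔇.DG ((t₀ : ↥(unitaryGroupOfForm (conjLocal L (IsCMField.complexConj L) v) (cmLocalForm L 3 v))) : Gqs L v) := by
  filter_upwards [eventually_vanDijkWeight_eq_of_isRegularElt L v t₀ hreg] with t ht
  rw [F0P3cStCharTSDGField.DG_coe_torus_eq_vanDijkWeight_re L v hns 𝔇 hDG t, F0P3cStCharTSDGField.DG_coe_torus_eq_vanDijkWeight_re L v hns 𝔇 hDG t₀, ht]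

/-- **(L3) for `D_G`**: an OPEN `U ∋ t₀` of `T`, inside `T^{reg}`, on which `D_G ∘ ι` is CONSTANT `= D_G(ι t₀)` (`v` non-split, `t₀` regular). [cite: HarishChandra1970, Lemma 22]
[cite: Rogawski1990, §12.5 p. 182] -/
theorem exists_isOpen_DG_coe_eq (hns : ∀ w : PlacesOver L v, IsCMField.complexConj L • w.1 = w.1)
    [MeasurableSpace (Gqs L v)]
    [∀ γ : Gqs L v, MeasurableSpace (Gqs L v ⧸ Subgroup.centralizer ({γ} : Set (Gqs L v)))] [MeasurableSpace (Gqs L v ⧸ Subgroup.center (Gqs L v))]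
    (𝔇 : Ch12Sec5.EllipticData (Gqs L v) H)
    (hDG : ∀ g : Gqs L v, 𝔇.DG g =
      ((NNReal.sqrt (NNReal.sqrt
        ((∏ w : PlacesOver L v, Literature.NumberTheory.GaloisRepresentations.IsNonarchimedeanLocalField.normAbs (w.1.adicCompletion L)
            (((g.val : GL (Fin 3) (UnitaryGroup.LocalRing L v)).val.charpoly.discr) w)) *
          ((∏ w : PlacesOver L v, Literature.NumberTheory.GaloisRepresentations.IsNonarchimedeanLocalField.normAbs (w.1.adicCompletion L)
            (((g.val : GL (Fin 3) (UnitaryGroup.LocalRing L v)).val.det) w)) ^ 2)⁻¹)) : ℝ≥0) : ℝ))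
    (t₀ : ↥(cmBorelTriple L 3 v).M)
    (hreg : IsRegularElt (((t₀ : ↥(unitaryGroupOfForm (conjLocal L (IsCMField.complexConj L) v) (cmLocalForm L 3 v))) : GL (Fin 3) (LocalRing L v)))) :
    ∃ U : Set ↥(cmBorelTriple L 3 v).M, IsOpen U ∧ t₀ ∈ U ∧ ∀ t : ↥(cmBorelTriple L 3 v).M, t ∈ U →
      IsRegularElt (((t : ↥(unitaryGroupOfForm (conjLocal L (IsCMField.complexConj L) v) (cmLocalForm L 3 v))) : GL (Fin 3) (LocalRing L v))) ∧
      𝔇.DG ((t : ↥(unitaryGroupOfForm (conjLocal L (IsCMField.complexConj L) v) (cmLocalForm L 3 v))) : Gqs L v) =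
      𝔇.DG ((t₀ : ↥(unitaryGroupOfForm (conjLocal L (IsCMField.complexConj L) v) (cmLocalForm L 3 v))) : Gqs L v) := by
  obtain ⟨U, hU, hUo, ht₀⟩ := mem_nhds_iff.1
    ((eventually_isRegularElt_and_valued_rootUnits_eq L v t₀ hreg (glDiagonal_torusEntry_eq L v t₀)).and (eventually_DG_coe_eq L v hns 𝔇 hDG t₀ hreg))
  exact ⟨U, hUo, ht₀, fun t ht => ⟨((hU ht).1 _ (glDiagonal_torusEntry_eq L v t)).1, (hU ht).2⟩⟩

end CM

end Summit.HodgeConjecture.HodgeConjecture.Cruxes.H413.F0P3cStCharTSWeightLocConst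

end
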